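import Literature.Analysis.ValidatedNumerics.TaylorModel
import HarnessLib

/-!
# Polynomials whose coefficients are Taylor models

Trunk T-ANA (Analysis/ValidatedNumerics); namespace `Literature.Analysis.ValidatedNumerics.PolyMP`.
Sequel of `TaylorModel.lean`: a polynomial in an outer variable `t` whose coefficients depend on a
parameter `ρ`, `|ρ| ≤ h`, is represented by a list of Taylor models (`TPoly = List IPoly`), with the
semantics `TPMem S h fs Ps` = coefficientwise `TMem`. Contents: generic coefficient-list
arithmetic `addL`, `smulL`, `mulL` (any type with `+`, `*`, `0`; at `ℝ` they are `addR`, `smulR`,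
`mulR` of `IntervalPolynomial.lean`, at `ℝ → ℝ` they commute with evaluation at `ρ`), the
Taylor-model operations `tpadd`, `tpsmul`, `tpmul`, `tpneg` with their soundness, and the passage
to a fixed parameter value: `tboundI` encloses a Taylor model in one interval, so that for each `ρ`
the real coefficient list lies in the interval polynomial `Ps.map (tboundI S h)` and the sign checker
`posOn` of `IntervalPolynomial.lean` applies (`pmem_map_tboundI`). The motivating shape is a
parameter-dependent barrier polynomial (a polynomial in a curve parameter `t` whose coefficients
depend on a model parameter, as in Buckmaster–Cao-Labora–Gómez-Serrano, App. B); the file is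
problem-independent. No facts, no axioms.

## References

* K. Makino, M. Berz, *Taylor models and other validated functional inclusion methods*,
  Int. J. Pure Appl. Math. 4 (2003), 379–456. [folklore]
* T. Buckmaster, G. Cao-Labora, J. Gómez-Serrano, *Smooth imploding solutions for 3D compressible
  fluids*, Forum Math. Pi 13 (2025) e6, Appendix B. [cite: BuckmasterCaolaboraGomezserrano2025, Appendix B]
-/

namespace Literature.Analysis.ValidatedNumerics

namespace PolyMP

open Literature.Analysis.ValidatedNumerics.NumericsMP

/-! ### Generic coefficient-list arithmetic -/

section Generic

variable {α : Type*}

/-- Coefficientwise sum. [folklore] -/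
def addL [Add α] : List α → List α → List α
  | [], bs => bs
  | a :: as, [] => a :: as
  | a :: as, b :: bs => (a + b) :: addL as bs

/-- Scalar multiple. [folklore] -/
def smulL [Mul α] (c : α) (as : List α) : List α := as.map (c * ·)

/-- Product (same recursion as `mulR`). [folklore] -/
def mulL [Add α] [Mul α] [Zero α] : List α → List α → List α
  | [], _ => []
  | a :: as, bs => addL (smulL a bs) (0 :: mulL as bs)

/-- [folklore] -/
theorem addL_real : ∀ (as bs : List ℝ), addL as bs = addR as bs
  | [], bs => by simp [addL, addR]
  | a :: as, [] => by simp [addL, addR]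
  | a :: as, b :: bs => by simp [addL, addR, addL_real as bs]

/-- [folklore] -/
theorem smulL_real (c : ℝ) (as : List ℝ) : smulL c as = smulR c as := rfl

/-- [folklore] -/
theorem mulL_real : ∀ (as bs : List ℝ), mulL as bs = mulR as bs
  | [], bs => by simp [mulL, mulR]
  | a :: as, bs => by simp [mulL, mulR, addL_real, smulL_real, mulL_real as bs]

/-- Evaluation of function lists at a parameter value. [folklore] -/
def evalAt (ρ : ℝ) (fs : List (ℝ → ℝ)) : List ℝ := fs.map (fun f => f ρ)

/-- [folklore] -/
@[simp] theorem evalAt_nil (ρ : ℝ) : evalAt ρ [] = [] := rfl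

/-- [folklore] -/
@[simp] theorem evalAt_cons (ρ : ℝ) (f : ℝ → ℝ) (fs : List (ℝ → ℝ)) :
    evalAt ρ (f :: fs) = f ρ :: evalAt ρ fs := rfl

/-- [folklore] -/
theorem evalAt_addL (ρ : ℝ) : ∀ (fs gs : List (ℝ → ℝ)),
    evalAt ρ (addL fs gs) = addR (evalAt ρ fs) (evalAt ρ gs)
  | [], gs => by simp [addL, addR]
  | f :: fs, [] => by simp [addL, addR]
  | f :: fs, g :: gs => by simp [addL, addR, evalAt_addL ρ fs gs]

/-- [folklore] -/
theorem evalAt_smulL (ρ : ℝ) (c : ℝ → ℝ) (fs : List (ℝ → ℝ)) :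
    evalAt ρ (smulL c fs) = smulR (c ρ) (evalAt ρ fs) := by
  induction fs with
  | nil => simp [smulL, smulR, evalAt]
  | cons f fs ih => simp [smulL, smulR, evalAt] at ih ⊢

/-- [folklore] -/
theorem evalAt_mulL (ρ : ℝ) : ∀ (fs gs : List (ℝ → ℝ)),
    evalAt ρ (mulL fs gs) = mulR (evalAt ρ fs) (evalAt ρ gs)
  | [], gs => by simp [mulL, mulR]
  | f :: fs, gs => by
      simp only [mulL, mulR, evalAt_addL, evalAt_smulL, evalAt_cons, Pi.zero_apply,
        evalAt_mulL ρ fs gs]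

end Generic

/-! ### Taylor-model coefficient lists -/

/-- A polynomial whose coefficients are Taylor models. [folklore] -/
abbrev TPoly := List IPoly

/-- Coefficientwise Taylor-model membership. [folklore] -/
def TPMem (S : ℕ) (h : ℚ) (fs : List (ℝ → ℝ)) (Ps : TPoly) : Prop := List.Forall₂ (TMem S h) fs Ps

/-- [folklore] -/
theorem tpmem_nil (S : ℕ) (h : ℚ) : TPMem S h [] [] := List.Forall₂.nil

/-- [folklore] -/
theorem tpmem_cons {S : ℕ} {h : ℚ} {f : ℝ → ℝ} {P : IPoly} {fs : List (ℝ → ℝ)} {Ps : TPoly}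
    (hf : TMem S h f P) (hfs : TPMem S h fs Ps) : TPMem S h (f :: fs) (P :: Ps) :=
  List.Forall₂.cons hf hfs

/-- Sum. [folklore] -/
def tpadd : TPoly → TPoly → TPoly
  | [], Qs => Qs
  | P :: Ps, [] => P :: Ps
  | P :: Ps, Q :: Qs => taddI P Q :: tpadd Ps Qs

/-- [folklore] -/
theorem tpmem_add {S : ℕ} {h : ℚ} : ∀ {fs gs : List (ℝ → ℝ)} {Ps Qs : TPoly},
    TPMem S h fs Ps → TPMem S h gs Qs → TPMem S h (addL fs gs) (tpadd Ps Qs)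
  | _, _, _, _, List.Forall₂.nil, hQ => by simpa [addL, tpadd] using hQ
  | _, _, _, _, List.Forall₂.cons (a := f) (b := P) (l₁ := fs) (l₂ := Ps) hf hP,
      List.Forall₂.nil => by
      simp only [addL, tpadd]
      exact List.Forall₂.cons hf hP
  | _, _, _, _, List.Forall₂.cons (a := f) (b := P) hf hP,
      List.Forall₂.cons (a := g) (b := Q) hg hQ => by
      simp only [addL, tpadd]
      exact List.Forall₂.cons (tmem_add hf hg) (tpmem_add hP hQ)

/-- Product of every coefficient with one Taylor model. [folklore] -/
def tpsmul (S : ℕ) (h : ℚ) (D : ℕ) (C : IPoly) (Ps : TPoly) : TPoly := Ps.map (tmulI S h D C)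

/-- [folklore] -/
theorem tpmem_smul {S : ℕ} (hS : 0 < S) {h : ℚ} (h0 : 0 ≤ h) (D : ℕ) {c : ℝ → ℝ} {C : IPoly}
    (hc : TMem S h c C) : ∀ {fs : List (ℝ → ℝ)} {Ps : TPoly},
    TPMem S h fs Ps → TPMem S h (smulL c fs) (tpsmul S h D C Ps)
  | _, _, List.Forall₂.nil => List.Forall₂.nil
  | _, _, List.Forall₂.cons (a := f) (b := P) hf hP => by
      simp only [smulL, tpsmul, List.map_cons]
      exact List.Forall₂.cons (tmem_mul hS h0 D hc hf) (tpmem_smul hS h0 D hc hP)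

/-- The zero Taylor model. [folklore] -/
def tzero (S : ℕ) : IPoly := [MI.ofInt S 0]

/-- [folklore] -/
theorem tmem_zero (S : ℕ) (h : ℚ) : TMem S h (0 : ℝ → ℝ) (tzero S) :=
  tmem_const (S := S) (h := h) (x := 0) (by simpa using MI.mem_ofInt S 0)

/-- Product. [folklore] -/
def tpmul (S : ℕ) (h : ℚ) (D : ℕ) : TPoly → TPoly → TPoly
  | [], _ => []
  | P :: Ps, Qs => tpadd (tpsmul S h D P Qs) (tzero S :: tpmul S h D Ps Qs)

/-- [folklore] -/
theorem tpmem_mul {S : ℕ} (hS : 0 < S) {h : ℚ} (h0 : 0 ≤ h) (D : ℕ) :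
    ∀ {fs gs : List (ℝ → ℝ)} {Ps Qs : TPoly},
    TPMem S h fs Ps → TPMem S h gs Qs → TPMem S h (mulL fs gs) (tpmul S h D Ps Qs)
  | _, _, _, _, List.Forall₂.nil, _ => by simpa [mulL, tpmul] using tpmem_nil S h
  | _, _, _, _, List.Forall₂.cons (a := f) (b := P) hf hP, hQ => by
      simp only [mulL, tpmul]
      exact tpmem_add (tpmem_smul hS h0 D hf hQ) (tpmem_cons (tmem_zero S h) (tpmem_mul hS h0 D hP hQ))

/-- Negation. [folklore] -/
def tpneg (Ps : TPoly) : TPoly := Ps.map tnegI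

/-- [folklore] -/
theorem tpmem_neg {S : ℕ} {h : ℚ} : ∀ {fs : List (ℝ → ℝ)} {Ps : TPoly},
    TPMem S h fs Ps → TPMem S h (fs.map (fun f ρ => -f ρ)) (tpneg Ps)
  | _, _, List.Forall₂.nil => List.Forall₂.nil
  | _, _, List.Forall₂.cons (a := f) (b := P) hf hP => by
      simp only [tpneg, List.map_cons]
      exact List.Forall₂.cons (tmem_neg hf) (tpmem_neg hP)

/-- Prepending `k` zero coefficients (multiplication by `t^k`). [folklore] -/
def tpshift (S : ℕ) (k : ℕ) (Ps : TPoly) : TPoly := List.replicate k (tzero S) ++ Ps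

/-- [folklore] -/
theorem tpmem_shift {S : ℕ} {h : ℚ} (k : ℕ) {fs : List (ℝ → ℝ)} {Ps : TPoly} (hP : TPMem S h fs Ps) :
    TPMem S h (List.replicate k (0 : ℝ → ℝ) ++ fs) (tpshift S k Ps) := by
  induction k with
  | zero => simpa [tpshift] using hP
  | succ k ih =>
    simp only [tpshift, List.replicate_succ, List.cons_append] at ih ⊢
    exact List.Forall₂.cons (tmem_zero S h) ih

/-! ### Fixing the parameter: enclosure of each coefficient by one interval -/

/-- One interval enclosing a Taylor model on `|ρ| ≤ h`. [folklore] -/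
def tboundI (S : ℕ) (h : ℚ) (P : IPoly) : MI := ⟨tlowerI S h P, tupperI S h P⟩

/-- [folklore] -/
theorem mem_tboundI {S : ℕ} {h : ℚ} (h0 : 0 ≤ h) {f : ℝ → ℝ} {P : IPoly} (hf : TMem S h f P)
    {ρ : ℝ} (hρ : |ρ| ≤ h) : MI.mem S (f ρ) (tboundI S h P) :=
  ⟨tlowerI_le h0 hf hρ, le_tupperI h0 hf hρ⟩

/-- For each admissible parameter value the real coefficient list lies in the interval polynomial
`Ps.map (tboundI S h)`. [folklore] -/
theorem pmem_map_tboundI {S : ℕ} {h : ℚ} (h0 : 0 ≤ h) {ρ : ℝ} (hρ : |ρ| ≤ h) :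
    ∀ {fs : List (ℝ → ℝ)} {Ps : TPoly}, TPMem S h fs Ps → PMem S (evalAt ρ fs) (Ps.map (tboundI S h))
  | _, _, List.Forall₂.nil => pmem_nil S
  | _, _, List.Forall₂.cons (a := f) (b := P) hf hP => by
      simp only [evalAt_cons, List.map_cons]
      exact pmem_cons (mem_tboundI h0 hf hρ) (pmem_map_tboundI h0 hρ hP)

/-- **Uniform positivity in the outer variable.** If the interval polynomial of coefficient bounds
is certified positive on `[lo, hi]` by `posOn`, then for every `|ρ| ≤ h` the real polynomial
`t ↦ Σ fᵢ(ρ) tⁱ` is positive on `[lo, hi]`. [folklore] -/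
theorem tpoly_pos_of_posOn {S : ℕ} (hS : 0 < S) {h : ℚ} (h0 : 0 ≤ h) {d : ℕ} {fs : List (ℝ → ℝ)}
    {Ps : TPoly} (hP : TPMem S h fs Ps) {lo hi : ℚ}
    (hpos : posOn S d (Ps.map (tboundI S h)) lo hi = true) (hle : lo ≤ hi) {ρ : ℝ} (hρ : |ρ| ≤ h)
    {t : ℝ} (ht1 : (lo : ℝ) ≤ t) (ht2 : t ≤ hi) : 0 < evalR (evalAt ρ fs) t :=
  posOn_sound hS hpos hle (pmem_map_tboundI h0 hρ hP) ht1 ht2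

/-- **Uniform negativity in the outer variable.** [folklore] -/
theorem tpoly_neg_of_negOn {S : ℕ} (hS : 0 < S) {h : ℚ} (h0 : 0 ≤ h) {d : ℕ} {fs : List (ℝ → ℝ)}
    {Ps : TPoly} (hP : TPMem S h fs Ps) {lo hi : ℚ}
    (hneg : negOn S d (Ps.map (tboundI S h)) lo hi = true) (hle : lo ≤ hi) {ρ : ℝ} (hρ : |ρ| ≤ h)
    {t : ℝ} (ht1 : (lo : ℝ) ≤ t) (ht2 : t ≤ hi) : evalR (evalAt ρ fs) t < 0 :=
  negOn_sound hS hneg hle (pmem_map_tboundI h0 hρ hP) ht1 ht2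

end PolyMP

end Literature.Analysis.ValidatedNumerics
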